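import Literature.Geometry.Riemannian.HamiltonODEPositiveCone
import Mathlib.Analysis.InnerProductSpace.Adjoint
import Mathlib.Analysis.Matrix.Hermitian
import HarnessLib

/-!
# Hamilton 1986, Thm. 8.3 (pointwise): the image of the curvature operator is a Lie subalgebra
(topic `Geometry/Riemannian`)

A brick of the printed proof of the named fact
`Literature.Geometry.Riemannian.hamilton_nonnegCurvatureOperator_classification_four`
(`HamiltonNCOClassification.lean`; R. S. Hamilton, *Four-manifolds with positive curvature
operator*, J. Differential Geom. 24 (1986), **Thm. 1.3**, p. 154: compact four-manifolds with
non-negative curvature operator are quotients of `S⁴`, `CP²`, `S³ × R¹`, `S² × S²`, `S² × R²`,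
`R⁴`), hence of its simply connected consequence `hamilton1986_nonnegCurvatureOperator_four`
(`HamiltonNonnegCurvatureOperator.lean`, reduction in `HamiltonNonnegCurvatureOperatorProofs.lean`).
The proof of Thm. 1.3 is §8–§9 of the paper: under the Ricci flow the curvature operator `M`
satisfies `∂M/∂t = ΔM + φ(M)`, `φ(M) = M² + M^#` (§2, p. 157); **Lemma 8.2** (pp. 174–175, the
strong maximum principle for such systems) gives an interval `0 < t < δ` on which `M ≥ 0` has
constant rank and a null space invariant under parallel translation, invariant in time, and
contained in the null space of `φ(M)`; then (p. 176, verbatim):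

> Note that if `M ≥ 0`, then `M² ≥ 0` and `M^# ≥ 0` […]. Hence for `0 < t < δ` the null space of
> `M` has constant rank and is invariant in time and under parallel translation. Moreover the null
> space of `M` must also lie in the null space of `M^#`. The image of `M` is everything
> perpendicular to the null space. Diagonalize `M` so that `M_{αβ} = 0` if `α ≤ k` and
> `M_{αα} > 0` if `α > k`. Then we must have `M^#_{αα} = 0` also for `α ≤ k`, so `c_{αβγ} = 0` if
> `α ≤ k` and `β, γ > k`. This first says that the image of `M` is a Lie subalgebra. (In fact it
> will be the subalgebra of the restricted holonomy group.) This proves the following result.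
> **8.3. Theorem.** If `M ≥ 0` at `t = 0`, then for some interval `0 < t < δ` the image of `M` is
> a Lie subalgebra of constant rank invariant under parallel translation and invariant in time.

§9 (p. 178) then runs through the Lie subalgebras `𝔤 ⊂ so(4) = so(3) × so(3)` case by case,
opening with "Note `𝔤` cannot embed in just one factor of `so(3) × so(3)`. This is because
`tr A = tr C` by the Bianchi identity, so `A = 0` if and only if `C = 0`."

This file PROVES the finite-dimensional algebra of that passage — everything between Lemma 8.2
and the words "Lie subalgebra", and the opening remark of §9 — in the block vocabulary of the
tree's Hamilton-1986 chain (`HamiltonCurvatureODE.lean`, `HamiltonODEPositiveCone.lean`: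
block triples `p = (A, B, C) : HamiltonODE.Blocks` of the curvature operator `M = (A B; ᵗB C)` on
`Λ² = Λ²₊ ⊕ Λ²₋ = ℝ³ × ℝ³`, the forms `quad p v = M(v, v)` and `sharpQuad p v = ½ M^#(v, v)`,
and the Gram identity `two_mul_sharpQuad_gram`: `2 · sharpQuad = Σₖₗ ⟨[ωₖ, ωₗ], v⟩²` for
`M = Σ ωₖ ᵗωₖ`). Everything is proved; no named fact (`def … : Prop`) is introduced; the three
definitions are plain data:

* `HamiltonODE.act p v` — `M v = (A x + B y, ᵗB x + C y)` (bundled: `actₗ p`, whose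
  `LinearMap.range` is the image `Im M` as a submodule); `HamiltonODE.ip v w` — the inner
  product `x · x' + y · y'` of `Λ²₊ ⊕ Λ²₋` (diagonal `normSq`); `HamiltonODE.bracket v w` — the
  Lie bracket of `so(4) ≅ so(3) ⊕ so(3)` in block coordinates, the cross product in each factor,
  in Hamilton's PRINTED convention (the bracket of `two_mul_sharpQuad_gram` / `sharpQuad` /
  `HamiltonODE.field`; in the frame convention of `CurvatureDecomposition.lean` the second
  component carries the opposite sign — see the caveat in the docstring of `bracket` and the
  transfer section `FrameConvention`: `flipSnd`, `flipSnd_bracket_flipSnd_mem_range_act`);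
  `HamiltonODE.gram ω` — the block triple of `Σₖ ωₖ ᵗωₖ`.
* `exists_eq_gram_of_quad_nonneg` — `M ≥ 0` (with `A`, `C` symmetric) is a Gram matrix
  (Hamilton's "Diagonalize `M`"; here `M = ᵗN N` through `CFC.sqrt`, as in
  `sharpQuad_nonneg_of_quad_nonneg`); `act_gram`, `quad_gram`, `two_mul_sharpQuad_gram'`,
  `act_gram_eq_zero_iff` — `M v`, `M(v,v)`, `M^#(v,v)` and `null M` on Gram data.
* `ip_bracket_act_act_eq_zero` — **`M ≥ 0`, `null M ⊂ null M^#` ⇒ `[M a, M b] ⊥ null M`**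
  (the sentence "`c_{αβγ} = 0` if `α ≤ k` and `β, γ > k`": `M^#(v, v) = ½ Σ ⟨[ωₖ, ωₗ], v⟩² = 0`
  on `null M` kills every `⟨[ωₖ, ωₗ], v⟩`).
* `exists_act_eq_of_forall_ip_eq_zero`, `mem_range_act_iff` — **"The image of `M` is everything
  perpendicular to the null space"** (`(ker M)^⊥ = Im M` for symmetric `M`, from Mathlib's
  `LinearMap.orthogonal_ker` on `EuclideanSpace ℝ (Fin 3 ⊕ Fin 3)`).
* `exists_act_eq_bracket_act_act`, `bracket_mem_range_act`, `bracket_mem_range_act'` — **the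
  image of `M` is closed under the bracket** (Thm. 8.3, pointwise; the primed version takes the
  null-space hypothesis in the quadratic shape `M(v,v) = 0 ⇒ M^#(v,v) = 0` delivered by Lemma 8.2,
  cf. `act_eq_zero_iff_quad_eq_zero`).
* `eq_zero_of_fst_eq_zero`, `eq_zero_of_snd_snd_eq_zero`, `eq_zero_of_forall_act_snd_eq_zero`,
  `eq_zero_of_forall_act_fst_eq_zero` — **§9, p. 178: "`A = 0` if and only if `C = 0`", "`𝔤`
  cannot embed in just one factor"**, for `M ≥ 0` with `tr A = tr C` (the Bianchi input is the
  tree's `trace_blockA_eq_trace_blockC`, `PinchingEstimatesConstraints.lean`): either vanishing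
  forces `M = 0`.
* `dotProduct_self_fst_eq_snd_of_range_subset_line` — **§9, case 2: "the image of `M` is spanned
  by a single two-form `φ`, and the Bianchi identity guarantees `φ` comes from a two-plane"**: if
  `M ≠ 0` has image on the line `ℝ φ`, `φ = (φ₊, φ₋)`, then `|φ₊|² = |φ₋|²` (decomposability).
* `bracket_eq_zero_of_mem_span`, `cross_eq_zero_of_mem_span` — behind **§9, case 3** ("two
  invariant 2-forms `φ ∈ Λ²₊` and `ψ ∈ Λ²₋`") and the list of subalgebras of `so(3)` (p. 176): a
  two-dimensional subalgebra of `so(3) × so(3)` is abelian (`[ω₁, ω₂] ∈ span ⇒ [ω₁, ω₂] = 0`), and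
  `(ℝ³, ×)` has no two-dimensional subalgebra (`finrank_ne_two_of_cross_mem`: "The only Lie
  subalgebras of `so(3)` are `{0}`, `so(3)` itself, and any one-dimensional subspace").
* `eq_zero_or_isometry_of_map_cross` — **§9, cases 4–5: "Each Lie algebra preserving map
  `so(3) → so(3)` […] is either zero or an isometry"**: a linear `L : ℝ³ → ℝ³` with
  `L(a × b) = La × Lb` is `0` or special orthogonal.
* Section `FrameConvention` — the same Thm. 8.3 statement in the frame convention of
  `CurvatureDecomposition.lean` (`flipSnd_bracket_flipSnd_mem_range_act`: for `M ≥ 0` with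
  `M v = 0 ⇒ ᵗx A^# x - 2 ᵗx B^# y + ᵗy C^# y = 0`, the image is closed under
  `(x × x', -(y × y'))`), obtained from the printed one through `reflectB` / `flipSnd`
  (`act_reflectB`, `sharpQuad_reflectB`, `range_act_reflectB`, `flipSndₗ`, `range_actₗ_reflectB`,
  `finrank_range_actₗ_reflectB`, `reflectB_null_iff`).

Not here (the rest of §§8–9): the parabolic strong maximum principle (Lemmas 8.1–8.2) and the
parallel-translation / time invariance in Thm. 8.3, the identification of `Im M` with the
holonomy algebra, the splitting lemma and the six cases of §9.

## References

* R. S. Hamilton, *Four-manifolds with positive curvature operator*, J. Differential Geom. 24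
  (1986) 153–179: §2, p. 157 (`M^#`, the Lie algebra square); §8, Lemma 8.2 and Thm. 8.3
  (pp. 174–176); §9, p. 176 (subalgebras of `so(3)`), pp. 178–179 (cases 2–5). [Hamilton1986]
-/

noncomputable section

open Matrix Finset
open scoped BigOperators

namespace Literature.Geometry.Riemannian

namespace HamiltonODE

/-! ### The action `M v`, the inner product and the Lie bracket on `Λ²₊ ⊕ Λ²₋ = ℝ³ × ℝ³` -/

/-- The curvature operator `M = (A B; ᵗB C)` applied to a 2-vector `v = (x, y) ∈ Λ²₊ ⊕ Λ²₋`: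
`M v = (A x + B y, ᵗB x + C y)` (so that `M(v, v) = ⟨v, M v⟩`, `quad_eq_ip_act`).
[cite: Hamilton1986, §6, p. 165] -/
def act (p : Blocks) (v : (Fin 3 → ℝ) × (Fin 3 → ℝ)) : (Fin 3 → ℝ) × (Fin 3 → ℝ) :=
  (p.1 *ᵥ v.1 + p.2.1 *ᵥ v.2, p.2.1ᵀ *ᵥ v.1 + p.2.2 *ᵥ v.2)

/-- The inner product `⟨v, w⟩ = x · x' + y · y'` on `Λ²₊ ⊕ Λ²₋ = ℝ³ × ℝ³` (the bases `φᵢ`, `ψᵢ`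
being orthonormal up to the common factor fixed in `CurvatureDecomposition.lean`); its diagonal
is `normSq`. [folklore] -/
def ip (v w : (Fin 3 → ℝ) × (Fin 3 → ℝ)) : ℝ := v.1 ⬝ᵥ w.1 + v.2 ⬝ᵥ w.2

/-- The Lie bracket of `so(4) = Λ²₊ ⊕ Λ²₋ ≅ so(3) ⊕ so(3)` in block coordinates, in
HAMILTON'S PRINTED CONVENTION (bases of `Λ²₊`, `Λ²₋` oriented alike as copies of `so(3)`, the
convention of `HamiltonODE.field`, `B' = AB + BC + 2B^#`, and of `sharpQuad`): the cross product
in each factor, `[(x, y), (x', y')] = (x × x', y × y')`, up to one common non-zero factor. This is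
the bracket for which `M^#(v, v) = ½ Σₖₗ ⟨[ωₖ, ωₗ], v⟩²` with the tree's `sharpQuad`
(`two_mul_sharpQuad_gram`). CAVEAT: in the frame convention of `CurvatureDecomposition.lean`
(`[φ₁, φ₂] = -2φ₃` but `[ψ₁, ψ₂] = +2ψ₃`, see the design notes of `HamiltonCurvatureODE.lean`) the
bracket of `so(4)` is `(x × x', -(y × y'))` up to a common factor, and the Lie square of `M` is
`ᵗx A^# x - 2 ᵗx B^# y + ᵗy C^# y`; the two conventions are exchanged by the reflection
`(x, y) ↦ (x, -y)` / `B ↦ -B` (`flipSnd`, `reflectB`), under which closedness is NOT invariant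
(e.g. `Λ²(e₀^⊥) = {x + y = 0}` is a subalgebra for the frame bracket and `{x = y}` for this one);
every statement below is in the printed convention and is transferred to the frame convention in
the section `FrameConvention` at the end of the file. [cite: Hamilton1986, §2, p. 157; §6, p. 166] -/
def bracket (v w : (Fin 3 → ℝ) × (Fin 3 → ℝ)) : (Fin 3 → ℝ) × (Fin 3 → ℝ) :=
  (v.1 ⨯₃ w.1, v.2 ⨯₃ w.2)

section ip

variable (u v w : (Fin 3 → ℝ) × (Fin 3 → ℝ)) (c : ℝ)

/-- The inner product is symmetric. [folklore] -/
theorem ip_comm : ip v w = ip w v := by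
  simp [ip, dotProduct_comm]

/-- Additivity on the left. [folklore] -/
theorem ip_add_left : ip (u + v) w = ip u w + ip v w := by
  simp only [ip, Prod.fst_add, Prod.snd_add, add_dotProduct]; ring

/-- Additivity on the right. [folklore] -/
theorem ip_add_right : ip u (v + w) = ip u v + ip u w := by
  simp only [ip, Prod.fst_add, Prod.snd_add, dotProduct_add]; ring

/-- Homogeneity on the left. [folklore] -/
theorem ip_smul_left : ip (c • v) w = c * ip v w := by
  simp only [ip, Prod.smul_fst, Prod.smul_snd, smul_dotProduct, smul_eq_mul]; ring

/-- Homogeneity on the right. [folklore] -/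
theorem ip_smul_right : ip v (c • w) = c * ip v w := by
  simp only [ip, Prod.smul_fst, Prod.smul_snd, dotProduct_smul, smul_eq_mul]; ring

/-- `⟨0, w⟩ = 0`. [folklore] -/
@[simp] theorem ip_zero_left : ip 0 w = 0 := by simp [ip]

/-- `⟨v, 0⟩ = 0`. [folklore] -/
@[simp] theorem ip_zero_right : ip v 0 = 0 := by simp [ip]

/-- `⟨v, v⟩ = |v|²` (`normSq`). [folklore] -/
theorem ip_self : ip v v = normSq v := rfl

/-- Finite additivity on the left. [folklore] -/
theorem ip_sum_left {κ : Type*} (s : Finset κ) (f : κ → (Fin 3 → ℝ) × (Fin 3 → ℝ)) :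
    ip (∑ k ∈ s, f k) w = ∑ k ∈ s, ip (f k) w := by
  classical
  induction s using Finset.induction_on with
  | empty => simp
  | insert a s ha ih => rw [sum_insert ha, sum_insert ha, ip_add_left, ih]

/-- Finite additivity on the right. [folklore] -/
theorem ip_sum_right {κ : Type*} (s : Finset κ) (f : κ → (Fin 3 → ℝ) × (Fin 3 → ℝ)) :
    ip v (∑ k ∈ s, f k) = ∑ k ∈ s, ip v (f k) := by
  rw [ip_comm, ip_sum_left]
  exact sum_congr rfl fun k _ ↦ ip_comm _ _

/-- `⟨v, ·⟩ = 0` for all test vectors forces `v = 0`. [folklore] -/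
theorem eq_zero_of_ip_self_eq_zero {v : (Fin 3 → ℝ) × (Fin 3 → ℝ)} (h : ip v v = 0) : v = 0 :=
  eq_zero_of_normSq_eq_zero h

end ip

section bracket

variable (u v w : (Fin 3 → ℝ) × (Fin 3 → ℝ)) (c : ℝ)

/-- The bracket is additive on the left. [folklore] -/
theorem bracket_add_left : bracket (u + v) w = bracket u w + bracket v w := by
  simp [bracket]

/-- The bracket is additive on the right. [folklore] -/
theorem bracket_add_right : bracket u (v + w) = bracket u v + bracket u w := by
  simp [bracket, map_add]

/-- The bracket is homogeneous on the left. [folklore] -/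
theorem bracket_smul_left : bracket (c • v) w = c • bracket v w := by
  simp [bracket]

/-- The bracket is homogeneous on the right. [folklore] -/
theorem bracket_smul_right : bracket v (c • w) = c • bracket v w := by
  simp [bracket, map_smul]

/-- `[0, w] = 0`. [folklore] -/
@[simp] theorem bracket_zero_left : bracket 0 w = 0 := by simp [bracket]

/-- `[v, 0] = 0`. [folklore] -/
@[simp] theorem bracket_zero_right : bracket v 0 = 0 := by simp [bracket]

/-- The bracket is skew. [folklore] -/
theorem bracket_anticomm : bracket v w = -bracket w v := by
  simp only [bracket, Prod.neg_mk, cross_anticomm]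

/-- `[v, v] = 0`. [folklore] -/
@[simp] theorem bracket_self : bracket v v = 0 := by simp [bracket]

/-- Finite additivity of the bracket on the left. [folklore] -/
theorem bracket_sum_left {κ : Type*} (s : Finset κ) (f : κ → (Fin 3 → ℝ) × (Fin 3 → ℝ)) :
    bracket (∑ k ∈ s, f k) w = ∑ k ∈ s, bracket (f k) w := by
  classical
  induction s using Finset.induction_on with
  | empty => simp
  | insert a s ha ih => rw [sum_insert ha, sum_insert ha, bracket_add_left, ih]

/-- Finite additivity of the bracket on the right. [folklore] -/
theorem bracket_sum_right {κ : Type*} (s : Finset κ) (f : κ → (Fin 3 → ℝ) × (Fin 3 → ℝ)) :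
    bracket v (∑ k ∈ s, f k) = ∑ k ∈ s, bracket v (f k) := by
  classical
  induction s using Finset.induction_on with
  | empty => simp
  | insert a s ha ih => rw [sum_insert ha, sum_insert ha, bracket_add_right, ih]

/-- `ad`-invariance of the inner product: `⟨[u, v], w⟩ = ⟨u, [v, w]⟩` (the scalar triple
product). [folklore] -/
theorem ip_bracket_left : ip (bracket u v) w = ip u (bracket v w) := by
  simp only [ip, bracket]
  rw [dotProduct_comm (u.1 ⨯₃ v.1) w.1, dotProduct_comm (u.2 ⨯₃ v.2) w.2,
    triple_product_permutation w.1 u.1 v.1, triple_product_permutation w.2 u.2 v.2]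

/-- `[u, v] ⊥ u`. [folklore] -/
@[simp] theorem ip_bracket_self_left : ip (bracket u v) u = 0 := by
  rw [ip_comm]; simp [ip, bracket, dot_self_cross]

/-- `[u, v] ⊥ v`. [folklore] -/
@[simp] theorem ip_bracket_self_right : ip (bracket u v) v = 0 := by
  rw [ip_comm]; simp [ip, bracket, dot_cross_self]

end bracket

/-! ### `M(v, v) = ⟨v, M v⟩`, symmetry of `M` -/

section act

variable (p : Blocks) (v w : (Fin 3 → ℝ) × (Fin 3 → ℝ))

/-- `M(v, v) = ⟨v, M v⟩`. [folklore] -/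
theorem quad_eq_ip_act : quad p v = ip v (act p v) := by
  obtain ⟨x, y⟩ := v
  simp only [quad, ip, act, dotProduct_add]
  have : y ⬝ᵥ (p.2.1ᵀ *ᵥ x) = x ⬝ᵥ (p.2.1 *ᵥ y) := by
    rw [mulVec_transpose, dotProduct_comm, dotProduct_mulVec]
  rw [this]; ring

/-- `M` is additive. [folklore] -/
theorem act_add_right : act p (v + w) = act p v + act p w := by
  simp only [act, Prod.fst_add, Prod.snd_add, mulVec_add, Prod.mk_add_mk]
  abel_nf

/-- `M` is homogeneous. [folklore] -/
theorem act_smul_right (c : ℝ) : act p (c • v) = c • act p v := by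
  simp only [act, Prod.smul_fst, Prod.smul_snd, mulVec_smul, Prod.smul_mk, smul_add]

/-- `M 0 = 0`. [folklore] -/
@[simp] theorem act_zero_right : act p 0 = 0 := by simp [act]

/-- `M = (A B; ᵗB C)` as a linear endomorphism of `Λ²₊ ⊕ Λ²₋ = ℝ³ × ℝ³` (the bundled form of
`act`, so that the image `Im M` is available as the submodule `LinearMap.range (actₗ p)` with its
dimension `= rank M`). [cite: Hamilton1986, §6, p. 165] -/
def actₗ (p : Blocks) : ((Fin 3 → ℝ) × (Fin 3 → ℝ)) →ₗ[ℝ] ((Fin 3 → ℝ) × (Fin 3 → ℝ)) where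
  toFun := act p
  map_add' := act_add_right p
  map_smul' c v := act_smul_right p v c

/-- `actₗ` is `act`. [folklore] -/
@[simp] theorem actₗ_apply : actₗ p v = act p v := rfl

variable {p} in
/-- The image submodule of `M` has underlying set the range of `act`. [folklore] -/
theorem mem_range_actₗ_iff (u : (Fin 3 → ℝ) × (Fin 3 → ℝ)) :
    u ∈ LinearMap.range (actₗ p) ↔ u ∈ Set.range (act p) := by
  rw [LinearMap.mem_range, Set.mem_range]
  rfl

variable {p} in
/-- `M` is symmetric for the inner product when `A` and `C` are: `⟨M v, w⟩ = ⟨v, M w⟩`.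
[folklore] -/
theorem ip_act_comm (hA : p.1.IsSymm) (hC : p.2.2.IsSymm) : ip (act p v) w = ip v (act p w) := by
  obtain ⟨A, B, C⟩ := p
  obtain ⟨x, y⟩ := v
  obtain ⟨x', y'⟩ := w
  simp only [ip, act, add_dotProduct, dotProduct_add]
  have hA' : Aᵀ = A := hA.eq
  have hC' : Cᵀ = C := hC.eq
  have e1 : (A *ᵥ x) ⬝ᵥ x' = x ⬝ᵥ (A *ᵥ x') := by
    rw [dotProduct_comm, dotProduct_mulVec, ← mulVec_transpose, hA', dotProduct_comm]
  have e2 : (C *ᵥ y) ⬝ᵥ y' = y ⬝ᵥ (C *ᵥ y') := by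
    rw [dotProduct_comm, dotProduct_mulVec, ← mulVec_transpose, hC', dotProduct_comm]
  have e3 : (B *ᵥ y) ⬝ᵥ x' = y ⬝ᵥ (Bᵀ *ᵥ x') := by
    rw [dotProduct_comm, dotProduct_mulVec, ← mulVec_transpose, dotProduct_comm]
  have e4 : (Bᵀ *ᵥ x) ⬝ᵥ y' = x ⬝ᵥ (B *ᵥ y') := by
    rw [dotProduct_comm, dotProduct_mulVec, ← mulVec_transpose, transpose_transpose,
      dotProduct_comm]
  rw [e1, e2, e3, e4]; ring

end act

/-! ### Gram data: `M = Σₖ ωₖ ᵗωₖ` -/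

/-- The block triple of the Gram matrix `Σₖ ωₖ ᵗωₖ` of a finite family `ωₖ = (pₖ, qₖ)`:
`A = Σ pₖ ᵗpₖ`, `B = Σ pₖ ᵗqₖ`, `C = Σ qₖ ᵗqₖ`. [folklore] -/
def gram {κ : Type*} [Fintype κ] (ω : κ → (Fin 3 → ℝ) × (Fin 3 → ℝ)) : Blocks :=
  (∑ k, vecMulVec (ω k).1 (ω k).1, ∑ k, vecMulVec (ω k).1 (ω k).2,
    ∑ k, vecMulVec (ω k).2 (ω k).2)

section gram

variable {κ : Type*} [Fintype κ] (ω : κ → (Fin 3 → ℝ) × (Fin 3 → ℝ))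

/-- `(Σₖ aₖ ᵗbₖ) z = Σₖ (bₖ · z) aₖ`. [folklore] -/
theorem sum_vecMulVec_mulVec (a b : κ → Fin 3 → ℝ) (z : Fin 3 → ℝ) :
    (∑ k, vecMulVec (a k) (b k)) *ᵥ z = ∑ k, (b k ⬝ᵥ z) • a k := by
  rw [sum_mulVec]
  refine sum_congr rfl fun k _ ↦ ?_
  rw [vecMulVec_mulVec, op_smul_eq_smul]

/-- `(Σ ωₖ ᵗωₖ) v = Σₖ ⟨ωₖ, v⟩ ωₖ`. [folklore] -/
theorem act_gram (v : (Fin 3 → ℝ) × (Fin 3 → ℝ)) : act (gram ω) v = ∑ k, ip (ω k) v • ω k := by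
  obtain ⟨x, y⟩ := v
  simp only [act, gram]
  have ht : (∑ k, vecMulVec (ω k).1 (ω k).2)ᵀ = ∑ k, vecMulVec (ω k).2 (ω k).1 := by
    rw [transpose_sum]
    simp [transpose_vecMulVec]
  rw [ht, sum_vecMulVec_mulVec, sum_vecMulVec_mulVec, sum_vecMulVec_mulVec, sum_vecMulVec_mulVec,
    ← sum_add_distrib, ← sum_add_distrib]
  refine Prod.ext ?_ ?_
  · rw [Prod.fst_sum]
    refine sum_congr rfl fun k _ ↦ ?_
    rw [Prod.smul_fst, ip, add_smul]
  · rw [Prod.snd_sum]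
    refine sum_congr rfl fun k _ ↦ ?_
    rw [Prod.smul_snd, ip, add_smul]

/-- `M(v, v) = Σₖ ⟨ωₖ, v⟩²` for Gram data. [folklore] -/
theorem quad_gram (v : (Fin 3 → ℝ) × (Fin 3 → ℝ)) : quad (gram ω) v = ∑ k, ip (ω k) v ^ 2 := by
  rw [quad_eq_ip_act, act_gram, ip_sum_right]
  refine sum_congr rfl fun k _ ↦ ?_
  rw [ip_smul_right, ip_comm, sq]

/-- `2 M^#(v, v) = Σₖ Σₗ ⟨[ωₖ, ωₗ], v⟩²` for Gram data (`two_mul_sharpQuad_gram`). [folklore] -/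
theorem two_mul_sharpQuad_gram' (v : (Fin 3 → ℝ) × (Fin 3 → ℝ)) :
    2 * sharpQuad (gram ω) v = ∑ k, ∑ l, ip (bracket (ω k) (ω l)) v ^ 2 := by
  obtain ⟨x, y⟩ := v
  have h := two_mul_sharpQuad_gram (fun k ↦ (ω k).1) (fun k ↦ (ω k).2) x y
  simp only [gram]
  rw [h]
  refine sum_congr rfl fun k _ ↦ sum_congr rfl fun l _ ↦ ?_
  simp only [ip, bracket, dotProduct_comm x, dotProduct_comm y]

/-- A Gram block triple has symmetric `A`. [folklore] -/
theorem isSymm_gram_fst : (gram ω).1.IsSymm := by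
  simp only [gram]
  rw [Matrix.IsSymm, transpose_sum]
  simp [transpose_vecMulVec]

/-- A Gram block triple has symmetric `C`. [folklore] -/
theorem isSymm_gram_snd_snd : (gram ω).2.2.IsSymm := by
  simp only [gram]
  rw [Matrix.IsSymm, transpose_sum]
  simp [transpose_vecMulVec]

/-- The null space of a Gram matrix: `M v = 0 ↔ ⟨ωₖ, v⟩ = 0` for all `k`. [folklore] -/
theorem act_gram_eq_zero_iff (v : (Fin 3 → ℝ) × (Fin 3 → ℝ)) :
    act (gram ω) v = 0 ↔ ∀ k, ip (ω k) v = 0 := by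
  constructor
  · intro h k
    have hq : quad (gram ω) v = 0 := by rw [quad_eq_ip_act, h, ip_zero_right]
    rw [quad_gram] at hq
    have := (sum_eq_zero_iff_of_nonneg fun k _ ↦ sq_nonneg (ip (ω k) v)).1 hq k (mem_univ _)
    exact pow_eq_zero_iff two_ne_zero |>.1 this
  · intro h
    rw [act_gram]
    exact sum_eq_zero fun k _ ↦ by rw [h k, zero_smul]

end gram

/-- **`M ≥ 0` is a Gram matrix**: if `A`, `C` are symmetric and `M(v, v) ≥ 0` for all `v`, then
`(A, B, C)` is the Gram triple of six vectors `ωₖ ∈ Λ²₊ ⊕ Λ²₋` (`M = ᵗN N` by the square root of a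
positive semidefinite matrix; the rows of `N`). [folklore] -/
theorem exists_eq_gram_of_quad_nonneg {p : Blocks} (hA : p.1.IsSymm) (hC : p.2.2.IsSymm)
    (h : ∀ v, 0 ≤ quad p v) :
    ∃ ω : Fin 3 ⊕ Fin 3 → (Fin 3 → ℝ) × (Fin 3 → ℝ), p = gram ω := by
  obtain ⟨A, B, C⟩ := p
  set S : Matrix (Fin 3 ⊕ Fin 3) (Fin 3 ⊕ Fin 3) ℝ := Matrix.fromBlocks A B Bᵀ C with hSdef
  have hSh : S.IsHermitian := by
    change Sᴴ = S
    rw [conjTranspose_eq_transpose_of_trivial, hSdef, fromBlocks_transpose, transpose_transpose]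
    have hA' : Aᵀ = A := hA.eq
    have hC' : Cᵀ = C := hC.eq
    rw [hA', hC']
  have hS : S.PosSemidef := by
    refine PosSemidef.of_dotProduct_mulVec_nonneg hSh fun w ↦ ?_
    rw [star_trivial, ← Sum.elim_comp_inl_inr w, hSdef, sumElim_dotProduct_fromBlocks_mulVec]
    exact h _
  obtain ⟨N, hN⟩ := exists_transpose_mul_self_of_posSemidef hS
  refine ⟨fun k ↦ (fun i ↦ N k (Sum.inl i), fun i ↦ N k (Sum.inr i)), ?_⟩
  simp only [gram, Prod.mk.injEq]
  refine ⟨?_, ?_, ?_⟩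
  · ext i j
    have := congr_fun (congr_fun hN (Sum.inl i)) (Sum.inl j)
    rw [hSdef, fromBlocks_apply₁₁, mul_apply] at this
    rw [this, Matrix.sum_apply]
    simp [vecMulVec_apply]
  · ext i j
    have := congr_fun (congr_fun hN (Sum.inl i)) (Sum.inr j)
    rw [hSdef, fromBlocks_apply₁₂, mul_apply] at this
    rw [this, Matrix.sum_apply]
    simp [vecMulVec_apply]
  · ext i j
    have := congr_fun (congr_fun hN (Sum.inr i)) (Sum.inr j)
    rw [hSdef, fromBlocks_apply₂₂, mul_apply] at this
    rw [this, Matrix.sum_apply]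
    simp [vecMulVec_apply]

/-! ### Theorem 8.3, pointwise: the image is closed under the bracket -/

/-- **Hamilton 1986, §8 (p. 176), the algebra of Thm. 8.3 — orthogonality form.** Let
`M = (A B; ᵗB C)` be a curvature operator in block form with `A`, `C` symmetric and `M ≥ 0`, and
suppose that the null space of `M` lies in the null space of `M^#` (`M v = 0 ⇒ M^#(v, v) = 0`; this
is what Lemma 8.2 delivers for the evolved metric, `null M ⊂ null (M² + M^#)`). Then for all
2-vectors `a`, `b` the bracket `[M a, M b]` is orthogonal to the null space of `M` — "Diagonalize
`M` so that `M_{αβ} = 0` if `α ≤ k` and `M_{αα} > 0` if `α > k`. Then we must have `M^#_{αα} = 0`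
also for `α ≤ k`, so `c_{αβγ} = 0` if `α ≤ k` and `β, γ > k`." Proof here: write `M = Σ ωₖ ᵗωₖ`;
then `2 M^#(v, v) = Σₖₗ ⟨[ωₖ, ωₗ], v⟩²` vanishes on `null M`, so every `[ωₖ, ωₗ] ⊥ null M`, and
`M a`, `M b` are combinations of the `ωₖ`. [cite: Hamilton1986, §8, Thm. 8.3 (proof, p. 176)] -/
theorem ip_bracket_act_act_eq_zero {p : Blocks} (hA : p.1.IsSymm) (hC : p.2.2.IsSymm)
    (hpos : ∀ v, 0 ≤ quad p v) (hnull : ∀ v, act p v = 0 → sharpQuad p v = 0)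
    (a b : (Fin 3 → ℝ) × (Fin 3 → ℝ)) {v : (Fin 3 → ℝ) × (Fin 3 → ℝ)} (hv : act p v = 0) :
    ip (bracket (act p a) (act p b)) v = 0 := by
  obtain ⟨ω, rfl⟩ := exists_eq_gram_of_quad_nonneg hA hC hpos
  -- every `[ωₖ, ωₗ]` is orthogonal to `v`
  have hkl : ∀ k l, ip (bracket (ω k) (ω l)) v = 0 := by
    have h2 := two_mul_sharpQuad_gram' ω v
    rw [hnull v hv, mul_zero] at h2
    intro k l
    have hk := (sum_eq_zero_iff_of_nonneg fun k _ ↦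
      sum_nonneg fun l _ ↦ sq_nonneg (ip (bracket (ω k) (ω l)) v)).1 h2.symm k (mem_univ _)
    have hl := (sum_eq_zero_iff_of_nonneg fun l _ ↦ sq_nonneg (ip (bracket (ω k) (ω l)) v)).1 hk
      l (mem_univ _)
    exact pow_eq_zero_iff two_ne_zero |>.1 hl
  rw [act_gram, act_gram, bracket_sum_left, ip_sum_left]
  refine sum_eq_zero fun k _ ↦ ?_
  rw [bracket_smul_left, ip_smul_left, bracket_sum_right, ip_sum_left]
  refine mul_eq_zero_of_right _ (sum_eq_zero fun l _ ↦ ?_)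
  rw [bracket_smul_right, ip_smul_left, hkl k l, mul_zero]

/-! ### The image of `M` is the orthogonal complement of its null space -/

/-- The easy inclusion `Im M ⊂ (null M)^⊥` for symmetric `M`: `⟨M c, v⟩ = ⟨c, M v⟩ = 0` when
`M v = 0`. [folklore] -/
theorem ip_act_eq_zero_of_act_eq_zero {p : Blocks} (hA : p.1.IsSymm) (hC : p.2.2.IsSymm)
    (c : (Fin 3 → ℝ) × (Fin 3 → ℝ)) {v : (Fin 3 → ℝ) × (Fin 3 → ℝ)} (hv : act p v = 0) :
    ip (act p c) v = 0 := by
  rw [ip_act_comm _ _ hA hC, hv, ip_zero_right]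

/-- **"The image of `M` is everything perpendicular to the null space"** (Hamilton 1986, p. 176),
for `M = (A B; ᵗB C)` with `A`, `C` symmetric: a 2-vector orthogonal to `null M` is of the form
`M c`. (Finite-dimensional linear algebra: `(ker M)^⊥ = Im ᵗM = Im M`, Mathlib's
`LinearMap.orthogonal_ker` on `ℝ⁶ = EuclideanSpace ℝ (Fin 3 ⊕ Fin 3)`, transported along
`(x, y) ↦ Sum.elim x y`.) [cite: Hamilton1986, §8, Thm. 8.3 (proof, p. 176)] -/
theorem exists_act_eq_of_forall_ip_eq_zero {p : Blocks} (hA : p.1.IsSymm) (hC : p.2.2.IsSymm)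
    {u : (Fin 3 → ℝ) × (Fin 3 → ℝ)} (hu : ∀ v, act p v = 0 → ip u v = 0) : ∃ c, act p c = u := by
  classical
  obtain ⟨A, B, C⟩ := p
  set S : Matrix (Fin 3 ⊕ Fin 3) (Fin 3 ⊕ Fin 3) ℝ := Matrix.fromBlocks A B Bᵀ C with hSdef
  have hSh : S.IsHermitian := by
    change Sᴴ = S
    rw [conjTranspose_eq_transpose_of_trivial, hSdef, fromBlocks_transpose, transpose_transpose]
    have hA' : Aᵀ = A := hA.eq
    have hC' : Cᵀ = C := hC.eq
    rw [hA', hC']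
  -- the block action through `Sum.elim`
  have hS : ∀ x y : Fin 3 → ℝ, S *ᵥ Sum.elim x y =
      Sum.elim (act (A, B, C) (x, y)).1 (act (A, B, C) (x, y)).2 := by
    intro x y
    rw [hSdef, fromBlocks_mulVec]
    rfl
  set T := Matrix.toEuclideanLin S with hTdef
  have hT : T.IsSymmetric := Matrix.isSymmetric_toEuclideanLin_iff.mpr hSh
  have hrange : LinearMap.range T = (LinearMap.ker T)ᗮ := by
    rw [LinearMap.orthogonal_ker, hT.adjoint_eq]
  have hmem : (WithLp.toLp 2 (Sum.elim u.1 u.2) : EuclideanSpace ℝ (Fin 3 ⊕ Fin 3)) ∈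
      (LinearMap.ker T)ᗮ := by
    rw [Submodule.mem_orthogonal]
    intro w hw
    rw [LinearMap.mem_ker] at hw
    set x : Fin 3 → ℝ := fun i ↦ w (Sum.inl i) with hx
    set y : Fin 3 → ℝ := fun i ↦ w (Sum.inr i) with hy
    have hw' : WithLp.ofLp w = Sum.elim x y := by
      ext (i | i) <;> rfl
    have hTw : S *ᵥ Sum.elim x y = 0 := by
      have h1 : WithLp.ofLp (T w) = 0 := by rw [hw]; rfl
      rwa [hTdef, Matrix.ofLp_toLpLin, Matrix.toLin'_apply, hw'] at h1
    rw [hS] at hTw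
    have hact : act (A, B, C) (x, y) = 0 := by
      refine Prod.ext (funext fun i ↦ ?_) (funext fun i ↦ ?_)
      · simpa using congr_fun hTw (Sum.inl i)
      · simpa using congr_fun hTw (Sum.inr i)
    have h0 := hu _ hact
    rw [EuclideanSpace.inner_eq_star_dotProduct, star_trivial, hw', WithLp.ofLp_toLp,
      sumElim_dotProduct_sumElim]
    simpa [ip] using h0
  rw [← hrange, LinearMap.mem_range] at hmem
  obtain ⟨c, hc⟩ := hmem
  refine ⟨(fun i ↦ c (Sum.inl i), fun i ↦ c (Sum.inr i)), ?_⟩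
  have hc' : WithLp.ofLp c = Sum.elim (fun i ↦ c (Sum.inl i)) (fun i ↦ c (Sum.inr i)) := by
    ext (i | i) <;> rfl
  have h1 : S *ᵥ (WithLp.ofLp c) = Sum.elim u.1 u.2 := by
    have := congrArg WithLp.ofLp hc
    rwa [hTdef, Matrix.ofLp_toLpLin, Matrix.toLin'_apply, WithLp.ofLp_toLp] at this
  rw [hc', hS] at h1
  refine Prod.ext (funext fun i ↦ ?_) (funext fun i ↦ ?_)
  · simpa using congr_fun h1 (Sum.inl i)
  · simpa using congr_fun h1 (Sum.inr i)

/-- The null space and the image of a symmetric `M` are orthogonal complements: `u ⊥ null M` iff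
`u ∈ Im M`. [folklore] -/
theorem mem_range_act_iff {p : Blocks} (hA : p.1.IsSymm) (hC : p.2.2.IsSymm)
    (u : (Fin 3 → ℝ) × (Fin 3 → ℝ)) :
    u ∈ Set.range (act p) ↔ ∀ v, act p v = 0 → ip u v = 0 := by
  constructor
  · rintro ⟨c, rfl⟩ v hv
    exact ip_act_eq_zero_of_act_eq_zero hA hC c hv
  · intro h
    obtain ⟨c, hc⟩ := exists_act_eq_of_forall_ip_eq_zero hA hC h
    exact ⟨c, hc⟩

/-! ### Theorem 8.3, pointwise: the image is a Lie subalgebra -/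

/-- **Hamilton 1986, Thm. 8.3 (pointwise algebra, p. 176): "This first says that the image of `M`
is a Lie subalgebra."** Let `M = (A B; ᵗB C)` be a curvature operator in block form, `A`, `C`
symmetric, with `M ≥ 0` and `null M ⊂ null M^#` (`M v = 0 ⇒ M^#(v, v) = 0`, the conclusion of
Lemma 8.2 for `φ(M) = M² + M^#`). Then the image of `M` is closed under the Lie bracket of
`so(4) = Λ²₊ ⊕ Λ²₋`: `[M a, M b] = M c` for some `c`. (In the paper `M` is the evolved curvature
operator on `0 < t < δ`, and the image is then the restricted holonomy algebra; here only the
linear algebra at one point is formalised.) [cite: Hamilton1986, §8, Thm. 8.3 (p. 176)] -/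
theorem exists_act_eq_bracket_act_act {p : Blocks} (hA : p.1.IsSymm) (hC : p.2.2.IsSymm)
    (hpos : ∀ v, 0 ≤ quad p v) (hnull : ∀ v, act p v = 0 → sharpQuad p v = 0)
    (a b : (Fin 3 → ℝ) × (Fin 3 → ℝ)) : ∃ c, act p c = bracket (act p a) (act p b) :=
  exists_act_eq_of_forall_ip_eq_zero hA hC fun _ hv ↦
    ip_bracket_act_act_eq_zero hA hC hpos hnull a b hv

/-- **The image of `M` is a Lie subalgebra** (Hamilton 1986, Thm. 8.3, pointwise), membership
form: `Im M` is closed under the bracket. [cite: Hamilton1986, §8, Thm. 8.3 (p. 176)] -/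
theorem bracket_mem_range_act {p : Blocks} (hA : p.1.IsSymm) (hC : p.2.2.IsSymm)
    (hpos : ∀ v, 0 ≤ quad p v) (hnull : ∀ v, act p v = 0 → sharpQuad p v = 0)
    {u w : (Fin 3 → ℝ) × (Fin 3 → ℝ)} (hu : u ∈ Set.range (act p)) (hw : w ∈ Set.range (act p)) :
    bracket u w ∈ Set.range (act p) := by
  obtain ⟨a, rfl⟩ := hu
  obtain ⟨b, rfl⟩ := hw
  obtain ⟨c, hc⟩ := exists_act_eq_bracket_act_act hA hC hpos hnull a b
  exact ⟨c, hc⟩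

/-- The same with the null-space hypothesis in the quadratic-form shape in which Lemma 8.2
produces it (`M(v, v) = 0 ⇒ M^#(v, v) = 0`; for `M ≥ 0`, `M(v, v) = 0 ↔ M v = 0`).
[cite: Hamilton1986, §8, Lemma 8.2 and Thm. 8.3 (pp. 174–176)] -/
theorem bracket_mem_range_act' {p : Blocks} (hA : p.1.IsSymm) (hC : p.2.2.IsSymm)
    (hpos : ∀ v, 0 ≤ quad p v) (hnull : ∀ v, quad p v = 0 → sharpQuad p v = 0)
    {u w : (Fin 3 → ℝ) × (Fin 3 → ℝ)} (hu : u ∈ Set.range (act p)) (hw : w ∈ Set.range (act p)) :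
    bracket u w ∈ Set.range (act p) :=
  bracket_mem_range_act hA hC hpos
    (fun v hv ↦ hnull v (by rw [quad_eq_ip_act, hv, ip_zero_right])) hu hw

/-- For `M ≥ 0` (with `A`, `C` symmetric) the null space is the null cone of the form:
`M v = 0 ↔ M(v, v) = 0`. [folklore] -/
theorem act_eq_zero_iff_quad_eq_zero {p : Blocks} (hA : p.1.IsSymm) (hC : p.2.2.IsSymm)
    (hpos : ∀ v, 0 ≤ quad p v) (v : (Fin 3 → ℝ) × (Fin 3 → ℝ)) :
    act p v = 0 ↔ quad p v = 0 := by
  obtain ⟨ω, rfl⟩ := exists_eq_gram_of_quad_nonneg hA hC hpos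
  rw [act_gram_eq_zero_iff, quad_gram]
  constructor
  · intro h
    exact sum_eq_zero fun k _ ↦ by rw [h k]; ring
  · intro h k
    have := (sum_eq_zero_iff_of_nonneg fun k _ ↦ sq_nonneg (ip (ω k) v)).1 h k (mem_univ _)
    exact pow_eq_zero_iff two_ne_zero |>.1 this

/-! ### §9, p. 178: the image cannot lie in one factor; rank one images are 2-planes -/

/-- The trace of a Gram block `A = Σ pₖ ᵗpₖ` is `Σ |pₖ|²`. [folklore] -/
theorem trace_gram_fst {κ : Type*} [Fintype κ] (ω : κ → (Fin 3 → ℝ) × (Fin 3 → ℝ)) :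
    (gram ω).1.trace = ∑ k, (ω k).1 ⬝ᵥ (ω k).1 := by
  simp only [gram, trace_sum]
  refine sum_congr rfl fun k _ ↦ ?_
  simp [Matrix.trace, vecMulVec_apply, dotProduct]

/-- The trace of a Gram block `C = Σ qₖ ᵗqₖ` is `Σ |qₖ|²`. [folklore] -/
theorem trace_gram_snd_snd {κ : Type*} [Fintype κ] (ω : κ → (Fin 3 → ℝ) × (Fin 3 → ℝ)) :
    (gram ω).2.2.trace = ∑ k, (ω k).2 ⬝ᵥ (ω k).2 := by
  simp only [gram, trace_sum]
  refine sum_congr rfl fun k _ ↦ ?_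
  simp [Matrix.trace, vecMulVec_apply, dotProduct]

/-- A real vector with `v · v = 0` vanishes. [folklore] -/
theorem eq_zero_of_dotProduct_self_eq_zero' {v : Fin 3 → ℝ} (h : v ⬝ᵥ v = 0) : v = 0 :=
  dotProduct_self_eq_zero.1 h

/-- **"`tr A = tr C` by the Bianchi identity, so `A = 0` if and only if `C = 0`"** (Hamilton 1986,
§9, case 2, p. 178), for `M = (A B; ᵗB C) ≥ 0` with `A`, `C` symmetric and `tr A = tr C` (the
consequence of the first Bianchi identity, `trace_blockA_eq_trace_blockC`): indeed either
vanishing forces `M = 0` (`A = Σ pₖ ᵗpₖ = 0` forces all `pₖ = 0`, then `tr C = Σ |qₖ|² = 0`).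
[cite: Hamilton1986, §9, case 2 (p. 178)] -/
theorem eq_zero_of_fst_eq_zero {p : Blocks} (hA : p.1.IsSymm) (hC : p.2.2.IsSymm)
    (hpos : ∀ v, 0 ≤ quad p v) (htr : p.1.trace = p.2.2.trace) (h : p.1 = 0) : p = 0 := by
  obtain ⟨ω, rfl⟩ := exists_eq_gram_of_quad_nonneg hA hC hpos
  have h1 : ∀ k, (ω k).1 = 0 := by
    intro k
    have ht : (gram ω).1.trace = 0 := by rw [h, trace_zero]
    rw [trace_gram_fst] at ht
    exact eq_zero_of_dotProduct_self_eq_zero' ((sum_eq_zero_iff_of_nonneg fun k _ ↦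
      dotProduct_self_star_nonneg (ω k).1).1 ht k (mem_univ _))
  have h2 : ∀ k, (ω k).2 = 0 := by
    intro k
    have ht : (gram ω).2.2.trace = 0 := by rw [← htr, h, trace_zero]
    rw [trace_gram_snd_snd] at ht
    exact eq_zero_of_dotProduct_self_eq_zero' ((sum_eq_zero_iff_of_nonneg fun k _ ↦
      dotProduct_self_star_nonneg (ω k).2).1 ht k (mem_univ _))
  have hω : ω = fun _ ↦ 0 := funext fun k ↦ Prod.ext (h1 k) (h2 k)
  subst hω
  simp [gram]

/-- Symmetrically: `C = 0` forces `M = 0`. [cite: Hamilton1986, §9, case 2 (p. 178)] -/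
theorem eq_zero_of_snd_snd_eq_zero {p : Blocks} (hA : p.1.IsSymm) (hC : p.2.2.IsSymm)
    (hpos : ∀ v, 0 ≤ quad p v) (htr : p.1.trace = p.2.2.trace) (h : p.2.2 = 0) : p = 0 := by
  obtain ⟨ω, rfl⟩ := exists_eq_gram_of_quad_nonneg hA hC hpos
  have h2 : ∀ k, (ω k).2 = 0 := by
    intro k
    have ht : (gram ω).2.2.trace = 0 := by rw [h, trace_zero]
    rw [trace_gram_snd_snd] at ht
    exact eq_zero_of_dotProduct_self_eq_zero' ((sum_eq_zero_iff_of_nonneg fun k _ ↦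
      dotProduct_self_star_nonneg (ω k).2).1 ht k (mem_univ _))
  have h1 : ∀ k, (ω k).1 = 0 := by
    intro k
    have ht : (gram ω).1.trace = 0 := by rw [htr, h, trace_zero]
    rw [trace_gram_fst] at ht
    exact eq_zero_of_dotProduct_self_eq_zero' ((sum_eq_zero_iff_of_nonneg fun k _ ↦
      dotProduct_self_star_nonneg (ω k).1).1 ht k (mem_univ _))
  have hω : ω = fun _ ↦ 0 := funext fun k ↦ Prod.ext (h1 k) (h2 k)
  subst hω
  simp [gram]

/-- **"`𝔤` cannot embed in just one factor of `so(3) × so(3)`"** (Hamilton 1986, §9, cases 2 and 4,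
p. 178): if the image of `M ≥ 0` (`A`, `C` symmetric, `tr A = tr C`) lies in `Λ²₊`, i.e. the
`Λ²₋`-component of every `M v` vanishes, then `M = 0`. [cite: Hamilton1986, §9, case 2 (p. 178)] -/
theorem eq_zero_of_forall_act_snd_eq_zero {p : Blocks} (hA : p.1.IsSymm) (hC : p.2.2.IsSymm)
    (hpos : ∀ v, 0 ≤ quad p v) (htr : p.1.trace = p.2.2.trace) (h : ∀ v, (act p v).2 = 0) :
    p = 0 := by
  refine eq_zero_of_snd_snd_eq_zero hA hC hpos htr ?_
  ext i j
  have := congr_fun (h (0, Pi.single j 1)) i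
  simpa [act] using this

/-- Likewise if the image lies in `Λ²₋`. [cite: Hamilton1986, §9, case 2 (p. 178)] -/
theorem eq_zero_of_forall_act_fst_eq_zero {p : Blocks} (hA : p.1.IsSymm) (hC : p.2.2.IsSymm)
    (hpos : ∀ v, 0 ≤ quad p v) (htr : p.1.trace = p.2.2.trace) (h : ∀ v, (act p v).1 = 0) :
    p = 0 := by
  refine eq_zero_of_fst_eq_zero hA hC hpos htr ?_
  ext i j
  have := congr_fun (h (Pi.single j 1, 0)) i
  simpa [act] using this

/-! ### §9, p. 178, case 2: a rank-one image is spanned by a 2-plane -/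

/-- `M v = 0` for all `v` forces `M = 0`. [folklore] -/
theorem eq_zero_of_forall_act_eq_zero {p : Blocks} (h : ∀ v, act p v = 0) : p = 0 := by
  obtain ⟨A, B, C⟩ := p
  have hA : A = 0 := by
    ext i j
    have := congr_fun (congr_arg Prod.fst (h (Pi.single j 1, 0))) i
    simpa [act] using this
  have hB : B = 0 := by
    ext i j
    have := congr_fun (congr_arg Prod.fst (h (0, Pi.single j 1))) i
    simpa [act] using this
  have hC : C = 0 := by
    ext i j
    have := congr_fun (congr_arg Prod.snd (h (0, Pi.single j 1))) i
    simpa [act] using this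
  simp [hA, hB, hC]

/-- **"Here the image of `M` is spanned by a single two-form `φ`, and the Bianchi identity
guarantees `φ` comes from a two-plane"** (Hamilton 1986, §9, case 2, p. 178). Block form: if
`M = (A B; ᵗB C) ≥ 0` (`A`, `C` symmetric) is non-zero with `tr A = tr C` and its image lies on the
line `ℝ φ`, `φ = (φ₊, φ₋) ∈ Λ²₊ ⊕ Λ²₋`, then `|φ₊|² = |φ₋|²` — which for a 2-form
`φ = φ₊ + φ₋ ∈ Λ² ℝ⁴` is the condition `φ ∧ φ = 0` of being decomposable, i.e. (dual to) a
2-plane. Proof: every Gram vector `ωₖ` of `M` lies in `Im M = ℝ φ`, so `tr A = (Σ tₖ²) |φ₊|²` and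
`tr C = (Σ tₖ²) |φ₋|²` with `Σ tₖ² ≠ 0`. [cite: Hamilton1986, §9, case 2 (p. 178)] -/
theorem dotProduct_self_fst_eq_snd_of_range_subset_line {p : Blocks} (hA : p.1.IsSymm)
    (hC : p.2.2.IsSymm) (hpos : ∀ v, 0 ≤ quad p v) (htr : p.1.trace = p.2.2.trace) (hp : p ≠ 0)
    {φ : (Fin 3 → ℝ) × (Fin 3 → ℝ)} (hφ : ∀ v, ∃ t : ℝ, act p v = t • φ) :
    φ.1 ⬝ᵥ φ.1 = φ.2 ⬝ᵥ φ.2 := by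
  obtain ⟨ω, rfl⟩ := exists_eq_gram_of_quad_nonneg hA hC hpos
  -- every Gram vector lies on the line `ℝ φ`
  have hline : ∀ k, ∃ t : ℝ, ω k = t • φ := by
    intro k
    set t : ℝ := ip (ω k) φ / ip φ φ with ht
    set r := ω k - t • φ with hr
    have hrφ : ip r φ = 0 := by
      by_cases h0 : ip φ φ = 0
      · have : φ = 0 := eq_zero_of_ip_self_eq_zero h0
        rw [this, ip_zero_right]
      · rw [hr, show ω k - t • φ = ω k + (-t) • φ by rw [neg_smul, sub_eq_add_neg], ip_add_left,
          ip_smul_left, ht]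
        field_simp
        ring
    -- `r ⊥ Im M`, hence `M r = 0`
    have hMr : act (gram ω) r = 0 := by
      have h1 : ∀ v, ip r (act (gram ω) v) = 0 := by
        intro v
        obtain ⟨s, hs⟩ := hφ v
        rw [hs, ip_smul_right, hrφ, mul_zero]
      have h2 : ip (act (gram ω) r) (act (gram ω) r) = 0 := by
        rw [ip_act_comm _ _ (isSymm_gram_fst ω) (isSymm_gram_snd_snd ω)]
        exact h1 _
      exact eq_zero_of_ip_self_eq_zero h2
    -- hence `ωₖ ⊥ r`, so `|r|² = ⟨ωₖ - t φ, r⟩ = 0`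
    have hkr : ip (ω k) r = 0 := (act_gram_eq_zero_iff ω r).1 hMr k
    have hrr : ip r r = 0 := by
      have e : r = ω k + (-t) • φ := by rw [hr, neg_smul, sub_eq_add_neg]
      conv_lhs => arg 1; rw [e]
      rw [ip_add_left, ip_smul_left, hkr, ip_comm φ r, hrφ]
      ring
    refine ⟨t, ?_⟩
    have := eq_zero_of_ip_self_eq_zero hrr
    rw [hr, sub_eq_zero] at this
    exact this
  choose t ht using hline
  have hA' : (gram ω).1.trace = (∑ k, t k ^ 2) * (φ.1 ⬝ᵥ φ.1) := by
    rw [trace_gram_fst, sum_mul]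
    refine sum_congr rfl fun k _ ↦ ?_
    rw [ht k, Prod.smul_fst, smul_dotProduct, dotProduct_smul, smul_eq_mul, smul_eq_mul]
    ring
  have hC' : (gram ω).2.2.trace = (∑ k, t k ^ 2) * (φ.2 ⬝ᵥ φ.2) := by
    rw [trace_gram_snd_snd, sum_mul]
    refine sum_congr rfl fun k _ ↦ ?_
    rw [ht k, Prod.smul_snd, smul_dotProduct, dotProduct_smul, smul_eq_mul, smul_eq_mul]
    ring
  have hsum : ∑ k, t k ^ 2 ≠ 0 := by
    intro h0
    have htk : ∀ k, t k = 0 := fun k ↦ pow_eq_zero_iff two_ne_zero |>.1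
      ((sum_eq_zero_iff_of_nonneg fun k _ ↦ sq_nonneg (t k)).1 h0 k (mem_univ _))
    apply hp
    apply eq_zero_of_forall_act_eq_zero
    intro v
    rw [act_gram]
    exact sum_eq_zero fun k _ ↦ by rw [ht k, htk k, zero_smul, smul_zero]
  rw [hA', hC'] at htr
  exact mul_left_cancel₀ hsum htr

/-! ### §9, p. 178, case 3: two-dimensional subalgebras are abelian -/

/-- **A two-dimensional Lie subalgebra of `so(4) = so(3) × so(3)` is abelian** (behind Hamilton
1986, §9, case 3, p. 178: "In this case there are two invariant 2-forms `φ ∈ Λ²₊` and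
`ψ ∈ Λ²₋`"): if `[ω₁, ω₂]` lies in the span of `ω₁` and `ω₂`, then `[ω₁, ω₂] = 0`, because the
bracket is orthogonal to both arguments (`ad`-invariance of the inner product). With
`ωᵢ = (pᵢ, qᵢ)` this says `p₁ × p₂ = 0` and `q₁ × q₂ = 0`: the `Λ²₊`-components are parallel and so
are the `Λ²₋`-components, so a two-dimensional subalgebra is `ℝ(φ, 0) ⊕ ℝ(0, ψ)`.
[cite: Hamilton1986, §9, case 3 (p. 178)] -/
theorem bracket_eq_zero_of_mem_span (ω₁ ω₂ : (Fin 3 → ℝ) × (Fin 3 → ℝ))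
    (h : ∃ a b : ℝ, bracket ω₁ ω₂ = a • ω₁ + b • ω₂) : bracket ω₁ ω₂ = 0 := by
  obtain ⟨a, b, hab⟩ := h
  apply eq_zero_of_ip_self_eq_zero
  conv_lhs => arg 2; rw [hab]
  rw [ip_add_right, ip_smul_right, ip_smul_right, ip_bracket_self_left, ip_bracket_self_right]
  ring

/-- The `so(3)` version: **`(ℝ³, ×)` has no two-dimensional subalgebra** — if `a × b` lies in the
span of `a` and `b` then `a × b = 0` (so `a`, `b` are parallel). This is why the subalgebras of
`so(3)` are `0`, the lines and `so(3)` (Hamilton 1986, §9, p. 176: "The only Lie subalgebras of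
`so(3)` are `{0}`, `so(3)` itself, and any one-dimensional subspace"), and why `so(3) × so(3)` has
no five-dimensional subalgebra. [cite: Hamilton1986, §9, p. 176] -/
theorem cross_eq_zero_of_mem_span (a b : Fin 3 → ℝ) (h : ∃ s t : ℝ, a ⨯₃ b = s • a + t • b) :
    a ⨯₃ b = 0 := by
  obtain ⟨s, t, hst⟩ := h
  rw [← dotProduct_self_eq_zero]
  conv_lhs => arg 2; rw [hst]
  rw [dotProduct_add, dotProduct_smul, dotProduct_smul, dotProduct_comm (a ⨯₃ b) a,
    dotProduct_comm (a ⨯₃ b) b, dot_self_cross, dot_cross_self]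
  simp

/-! ### §9: the subalgebras of `so(3)`, and Lie maps `so(3) → so(3)` (cases 4–5) -/

/-- **"The only Lie subalgebras of `so(3)` are `{0}`, `so(3)` itself, and any one-dimensional
subspace"** (Hamilton 1986, §9, p. 176), in the form: a subspace of `(ℝ³, ×)` closed under the
cross product does not have dimension two. [cite: Hamilton1986, §9, p. 176] -/
theorem finrank_ne_two_of_cross_mem (W : Submodule ℝ (Fin 3 → ℝ))
    (hW : ∀ a ∈ W, ∀ b ∈ W, a ⨯₃ b ∈ W) : Module.finrank ℝ W ≠ 2 := by
  intro h2
  let bW := Module.finBasisOfFinrankEq ℝ W h2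
  set a : Fin 3 → ℝ := ((bW 0 : W) : Fin 3 → ℝ) with ha
  set c : Fin 3 → ℝ := ((bW 1 : W) : Fin 3 → ℝ) with hc
  have hli : LinearIndependent ℝ ![a, c] := by
    have h := bW.linearIndependent.map' W.subtype W.ker_subtype
    have e : (W.subtype ∘ bW : Fin 2 → Fin 3 → ℝ) = ![a, c] := by
      ext i : 1
      fin_cases i <;> rfl
    rwa [e] at h
  have hmem : a ⨯₃ c ∈ W := hW a (bW 0).2 c (bW 1).2
  -- coordinates of `a × c` in the basis
  have hrepr : ∃ s t : ℝ, a ⨯₃ c = s • a + t • c := by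
    set w : W := ⟨a ⨯₃ c, hmem⟩ with hw
    have hsum := bW.sum_repr w
    refine ⟨bW.repr w 0, bW.repr w 1, ?_⟩
    have := congrArg (fun w : W ↦ (w : Fin 3 → ℝ)) hsum
    simp only [Fin.sum_univ_two, Submodule.coe_add, Submodule.coe_smul] at this
    exact this.symm
  have h0 := cross_eq_zero_of_mem_span a c hrepr
  exact (crossProduct_ne_zero_iff_linearIndependent.2 hli) h0

/-- The standard frame relations `e₀ × e₁ = e₂`, `e₁ × e₂ = e₀`, `e₂ × e₀ = e₁`. [folklore] -/
theorem cross_single_single :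
    (Pi.single 0 1 : Fin 3 → ℝ) ⨯₃ Pi.single 1 1 = Pi.single 2 1 ∧
      (Pi.single 1 1 : Fin 3 → ℝ) ⨯₃ Pi.single 2 1 = Pi.single 0 1 ∧
        (Pi.single 2 1 : Fin 3 → ℝ) ⨯₃ Pi.single 0 1 = Pi.single 1 1 := by
  refine ⟨?_, ?_, ?_⟩ <;>
  · ext i
    fin_cases i <;> simp [cross_apply]

/-- **"Each Lie algebra preserving map `so(3) → so(3)` […] is either zero or an isometry"**
(Hamilton 1986, §9, case 5, p. 179; case 4, p. 178: "any Lie algebra preserving map of `so(3)` to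
`so(3)`" is an isometry, whence "`𝔤` embeds as `{φ + Pφ}` where `P` is an isometry of `Λ²₊` to
`Λ²₋`"). For `so(3) = (ℝ³, ×)`: a linear map `L` with `L(a × b) = La × Lb` is `0` or a special
orthogonal transformation (`⟨La, Lb⟩ = ⟨a, b⟩` and `det L = 1`). Proof: the images `fᵢ` of the
standard frame satisfy `f₀ × f₁ = f₂` and cyclically, so they are pairwise orthogonal with
`|f₂| = |f₀| |f₁|` and cyclically; hence `|f₀| |f₁| |f₂| ∈ {0, 1}` and the frame is zero or
orthonormal and positively oriented. [cite: Hamilton1986, §9, cases 4–5 (pp. 178–179)] -/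
theorem eq_zero_or_isometry_of_map_cross (L : (Fin 3 → ℝ) →ₗ[ℝ] (Fin 3 → ℝ))
    (hL : ∀ a b, L (a ⨯₃ b) = L a ⨯₃ L b) :
    L = 0 ∨ ((∀ a b, L a ⬝ᵥ L b = a ⬝ᵥ b) ∧ LinearMap.det L = 1) := by
  obtain ⟨e01, e12, e20⟩ := cross_single_single
  set f : Fin 3 → Fin 3 → ℝ := fun i ↦ L (Pi.single i 1) with hf
  have h01 : f 0 ⨯₃ f 1 = f 2 := by simp only [hf]; rw [← hL, e01]
  have h12 : f 1 ⨯₃ f 2 = f 0 := by simp only [hf]; rw [← hL, e12]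
  have h20 : f 2 ⨯₃ f 0 = f 1 := by simp only [hf]; rw [← hL, e20]
  -- pairwise orthogonality
  have o01 : f 0 ⬝ᵥ f 1 = 0 := by rw [← h12, dotProduct_comm]; exact dot_self_cross _ _
  have o12 : f 1 ⬝ᵥ f 2 = 0 := by rw [← h20, dotProduct_comm]; exact dot_self_cross _ _
  have o20 : f 2 ⬝ᵥ f 0 = 0 := by rw [← h01, dotProduct_comm]; exact dot_self_cross _ _
  -- Lagrange's identity for the squared norms
  have n2 : f 2 ⬝ᵥ f 2 = (f 0 ⬝ᵥ f 0) * (f 1 ⬝ᵥ f 1) := by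
    rw [← h01, cross_dot_cross, o01, dotProduct_comm (f 1) (f 0), o01]; ring
  have n0 : f 0 ⬝ᵥ f 0 = (f 1 ⬝ᵥ f 1) * (f 2 ⬝ᵥ f 2) := by
    rw [← h12, cross_dot_cross, o12, dotProduct_comm (f 2) (f 1), o12]; ring
  have n1 : f 1 ⬝ᵥ f 1 = (f 2 ⬝ᵥ f 2) * (f 0 ⬝ᵥ f 0) := by
    rw [← h20, cross_dot_cross, o20, dotProduct_comm (f 0) (f 2), o20]; ring
  set a := f 0 ⬝ᵥ f 0 with ha
  set b := f 1 ⬝ᵥ f 1 with hb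
  set c := f 2 ⬝ᵥ f 2 with hc
  have a0 : 0 ≤ a := dotProduct_self_star_nonneg (f 0)
  have b0 : 0 ≤ b := dotProduct_self_star_nonneg (f 1)
  by_cases hz : a = 0
  · -- the frame vanishes, so `L = 0`
    left
    have f0 : f 0 = 0 := dotProduct_self_eq_zero.1 hz
    have f2 : f 2 = 0 := dotProduct_self_eq_zero.1 (by rw [← hc, n2, hz, zero_mul])
    have f1 : f 1 = 0 := by rw [← h20, f2, f0, cross_self]
    have hfi : ∀ i, f i = 0 := fun i ↦ by fin_cases i <;> assumption
    refine LinearMap.pi_ext' fun i ↦ LinearMap.ext_ring ?_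
    simpa [hf] using hfi i
  · right
    -- the frame is orthonormal
    have hb1 : b = 1 := by
      have h1 : a * (b ^ 2 - 1) = 0 := by
        have : a = b * (a * b) := by rw [← n2]; exact n0
        linear_combination -this
      have h2 : b ^ 2 = 1 := by
        have := (mul_eq_zero.1 h1).resolve_left hz
        linarith
      nlinarith
    have hca : c = a := by rw [n2, hb1, mul_one]
    have ha1 : a = 1 := by
      have h1 : b = a ^ 2 := by rw [n1, hca]; ring
      rw [hb1] at h1
      nlinarith
    have hc1 : c = 1 := by rw [hca, ha1]
    -- Gram matrix of the frame
    set M : Matrix (Fin 3) (Fin 3) ℝ := LinearMap.toMatrix' L with hM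
    have hcolM : ∀ i j, M i j = f j i := fun i j ↦ by
      rw [hM, LinearMap.toMatrix'_apply]
    have o10 : f 1 ⬝ᵥ f 0 = 0 := by rw [dotProduct_comm]; exact o01
    have o21 : f 2 ⬝ᵥ f 1 = 0 := by rw [dotProduct_comm]; exact o12
    have o02 : f 0 ⬝ᵥ f 2 = 0 := by rw [dotProduct_comm]; exact o20
    have hG : ∀ i j, f i ⬝ᵥ f j = if i = j then 1 else 0 := by
      intro i j
      fin_cases i <;> fin_cases j
      · simpa using ha1
      · simpa using o01
      · simpa using o02
      · simpa using o10
      · simpa using hb1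
      · simpa using o12
      · simpa using o20
      · simpa using o21
      · simpa using hc1
    have hMtM : Mᵀ * M = 1 := by
      ext i j
      rw [Matrix.mul_apply, Matrix.one_apply]
      have : ∑ k, Mᵀ i k * M k j = f i ⬝ᵥ f j := by
        simp only [Matrix.transpose_apply, hcolM, dotProduct]
      rw [this, hG]
    refine ⟨fun u v ↦ ?_, ?_⟩
    · rw [← LinearMap.toMatrix'_mulVec L u, ← LinearMap.toMatrix'_mulVec L v, ← hM,
        dotProduct_mulVec, ← mulVec_transpose, mulVec_mulVec, hMtM, one_mulVec]
    · rw [← LinearMap.det_toMatrix', ← hM, ← Matrix.det_transpose]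
      have hMt : Mᵀ = ![f 0, f 1, f 2] := by
        ext i j
        rw [Matrix.transpose_apply, hcolM]
        fin_cases i <;> rfl
      rw [hMt, ← triple_product_eq_det, h12]
      exact ha1

/-! ### The frame convention of `CurvatureDecomposition.lean`: transfer through `B ↦ -B` -/

section FrameConvention

/-- The reflection `(x, y) ↦ (x, -y)` of `Λ²₊ ⊕ Λ²₋` (reversing the orientation of the basis of
`Λ²₋`), which exchanges Hamilton's printed convention with the frame convention of
`CurvatureDecomposition.lean`; on block triples it is `reflectB`, `B ↦ -B`. [folklore] -/
def flipSnd (v : (Fin 3 → ℝ) × (Fin 3 → ℝ)) : (Fin 3 → ℝ) × (Fin 3 → ℝ) := (v.1, -v.2)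

/-- `flipSnd` is an involution. [folklore] -/
@[simp] theorem flipSnd_flipSnd (v : (Fin 3 → ℝ) × (Fin 3 → ℝ)) : flipSnd (flipSnd v) = v := by
  simp [flipSnd]

/-- `flipSnd (x, y) = (x, -y)`. [folklore] -/
@[simp] theorem flipSnd_mk (x y : Fin 3 → ℝ) : flipSnd (x, y) = (x, -y) := rfl

/-- `flipSnd` is homogeneous. [folklore] -/
theorem flipSnd_smul (t : ℝ) (v : (Fin 3 → ℝ) × (Fin 3 → ℝ)) : flipSnd (t • v) = t • flipSnd v := by
  obtain ⟨x, y⟩ := v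
  simp [flipSnd]

/-- `flipSnd v = 0 ↔ v = 0`. [folklore] -/
@[simp] theorem flipSnd_eq_zero_iff (v : (Fin 3 → ℝ) × (Fin 3 → ℝ)) : flipSnd v = 0 ↔ v = 0 := by
  obtain ⟨x, y⟩ := v
  simp [flipSnd, Prod.ext_iff]

/-- `(A, -B, C)` acts as the conjugate of `(A, B, C)` by the reflection:
`M' (x, -y) = flipSnd (M (x, y))`. [folklore] -/
theorem act_reflectB (p : Blocks) (v : (Fin 3 → ℝ) × (Fin 3 → ℝ)) :
    act (reflectB p) (flipSnd v) = flipSnd (act p v) := by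
  obtain ⟨A, B, C⟩ := p
  obtain ⟨x, y⟩ := v
  simp only [act, reflectB, flipSnd, Matrix.neg_mulVec, Matrix.mulVec_neg, neg_neg,
    Matrix.transpose_neg, Prod.mk.injEq, neg_add_rev]
  constructor
  · trivial
  · abel

/-- The quadratic form is conjugated likewise: `M'(flipSnd v, flipSnd v) = M(v, v)`. [folklore] -/
theorem quad_reflectB_flipSnd (p : Blocks) (v : (Fin 3 → ℝ) × (Fin 3 → ℝ)) :
    quad (reflectB p) (flipSnd v) = quad p v := by
  obtain ⟨x, y⟩ := v
  rw [flipSnd, quad_reflectB, neg_neg]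

/-- **`M^#` in the form `sharpQuad` is INVARIANT under `B ↦ -B`** (`(-B)^# = B^#`, `X^#` being
quadratic): this is why the reflection, and not `sharpQuad` itself, carries the change of
convention. [folklore] -/
theorem sharpQuad_reflectB (p : Blocks) (v : (Fin 3 → ℝ) × (Fin 3 → ℝ)) :
    sharpQuad (reflectB p) v = sharpQuad p v := by
  obtain ⟨A, B, C⟩ := p
  simp only [sharpQuad, reflectB, Matrix.sharp_neg]

/-- The Lie square of `M` in the FRAME convention, `ᵗx A^# x - 2 ᵗx B^# y + ᵗy C^# y`, is
`sharpQuad` at the reflected vector. [folklore] -/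
theorem sharpQuad_flipSnd (p : Blocks) (v : (Fin 3 → ℝ) × (Fin 3 → ℝ)) :
    sharpQuad p (flipSnd v) =
      v.1 ⬝ᵥ (p.1.sharp *ᵥ v.1) - 2 * (v.1 ⬝ᵥ (p.2.1.sharp *ᵥ v.2)) +
        v.2 ⬝ᵥ (p.2.2.sharp *ᵥ v.2) := by
  obtain ⟨x, y⟩ := v
  simp only [sharpQuad, flipSnd, Matrix.mulVec_neg, dotProduct_neg, neg_dotProduct, neg_neg]
  ring

/-- The image of `(A, -B, C)` is the reflection of the image of `(A, B, C)`. [folklore] -/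
theorem range_act_reflectB (p : Blocks) (u : (Fin 3 → ℝ) × (Fin 3 → ℝ)) :
    u ∈ Set.range (act (reflectB p)) ↔ flipSnd u ∈ Set.range (act p) := by
  constructor
  · rintro ⟨c, rfl⟩
    refine ⟨flipSnd c, ?_⟩
    have := act_reflectB p (flipSnd c)
    rw [flipSnd_flipSnd] at this
    rw [this, flipSnd_flipSnd]
  · rintro ⟨c, hc⟩
    refine ⟨flipSnd c, ?_⟩
    rw [act_reflectB, hc, flipSnd_flipSnd]

/-- `flipSnd` as a linear automorphism of `Λ²₊ ⊕ Λ²₋`. [folklore] -/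
def flipSndₗ : ((Fin 3 → ℝ) × (Fin 3 → ℝ)) ≃ₗ[ℝ] ((Fin 3 → ℝ) × (Fin 3 → ℝ)) :=
  LinearEquiv.prodCongr (LinearEquiv.refl ℝ _) (LinearEquiv.neg ℝ)

/-- `flipSndₗ` is `flipSnd`. [folklore] -/
@[simp] theorem flipSndₗ_apply (v : (Fin 3 → ℝ) × (Fin 3 → ℝ)) : flipSndₗ v = flipSnd v := rfl

/-- `flipSndₗ` is its own inverse. [folklore] -/
@[simp] theorem flipSndₗ_symm_apply (v : (Fin 3 → ℝ) × (Fin 3 → ℝ)) :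
    flipSndₗ.symm v = flipSnd v := by
  apply flipSndₗ.injective
  rw [LinearEquiv.apply_symm_apply, flipSndₗ_apply, flipSnd_flipSnd]

/-- **The image of `(A, -B, C)` is the reflected image of `(A, B, C)`**, as submodules.
[folklore] -/
theorem range_actₗ_reflectB (p : Blocks) :
    LinearMap.range (actₗ (reflectB p)) =
      (LinearMap.range (actₗ p)).map (flipSndₗ : _ →ₗ[ℝ] _) := by
  ext u
  rw [mem_range_actₗ_iff, range_act_reflectB, Submodule.mem_map_equiv, flipSndₗ_symm_apply,
    mem_range_actₗ_iff]

/-- Hence **`rank (A, -B, C) = rank (A, B, C)`**. [folklore] -/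
theorem finrank_range_actₗ_reflectB (p : Blocks) :
    Module.finrank ℝ (LinearMap.range (actₗ (reflectB p))) =
      Module.finrank ℝ (LinearMap.range (actₗ p)) := by
  rw [range_actₗ_reflectB, LinearEquiv.finrank_map_eq]

/-- The trace hypothesis `tr A = tr C` is reflection-invariant. [folklore] -/
theorem reflectB_trace_eq_iff (p : Blocks) :
    (reflectB p).1.trace = (reflectB p).2.2.trace ↔ p.1.trace = p.2.2.trace := Iff.rfl

/-- `M ≥ 0` is reflection-invariant (as a hypothesis on all of `Λ²`). [folklore] -/
theorem quad_reflectB_nonneg_iff (p : Blocks) :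
    (∀ v, 0 ≤ quad (reflectB p) v) ↔ ∀ v, 0 ≤ quad p v := by
  constructor
  · intro h v
    have := h (flipSnd v)
    rwa [quad_reflectB_flipSnd] at this
  · intro h v
    have := h (flipSnd v)
    rwa [← quad_reflectB_flipSnd, flipSnd_flipSnd] at this

/-- The frame-convention null-space hypothesis for `p` is the printed one for `reflectB p`.
[folklore] -/
theorem reflectB_null_iff (p : Blocks) :
    (∀ v, act (reflectB p) v = 0 → sharpQuad (reflectB p) v = 0) ↔
      ∀ v, act p v = 0 → sharpQuad p (flipSnd v) = 0 := by
  have key : ∀ v, act (reflectB p) v = 0 ↔ act p (flipSnd v) = 0 := by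
    intro v
    have e := act_reflectB p (flipSnd v)
    rw [flipSnd_flipSnd] at e
    rw [e, flipSnd_eq_zero_iff]
  constructor
  · intro h v hv
    have := h (flipSnd v) ((key _).2 (by rwa [flipSnd_flipSnd]))
    rwa [sharpQuad_reflectB] at this
  · intro h v hv
    rw [sharpQuad_reflectB]
    have := h _ ((key v).1 hv)
    rwa [flipSnd_flipSnd] at this

/-- **Thm. 8.3 (pointwise) in the frame convention of `CurvatureDecomposition.lean`.** Let
`M = (A B; ᵗB C) ≥ 0` (blocks in the tree's frame convention, `A`, `C` symmetric) and suppose the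
null space of `M` is killed by the Lie square of THAT convention,
`M v = 0 ⇒ ᵗx A^# x - 2 ᵗx B^# y + ᵗy C^# y = 0` (`= sharpQuad p (flipSnd v)`; this is what
Lemma 8.2 delivers for the true reaction term `(A² + BᵗB + 2A^#, AB + BC - 2B^#, C² + ᵗBB + 2C^#)`,
`reflectB_field_reflectB`). Then the image of `M` is closed under the bracket of that convention,
`[(x, y), (x', y')] ∝ (x × x', -(y × y'))`. Proof: `bracket_mem_range_act` for `reflectB p`.
[cite: Hamilton1986, §8, Thm. 8.3 (p. 176)] -/
theorem flipSnd_bracket_flipSnd_mem_range_act {p : Blocks} (hA : p.1.IsSymm) (hC : p.2.2.IsSymm)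
    (hpos : ∀ v, 0 ≤ quad p v) (hnull : ∀ v, act p v = 0 → sharpQuad p (flipSnd v) = 0)
    {u w : (Fin 3 → ℝ) × (Fin 3 → ℝ)} (hu : u ∈ Set.range (act p)) (hw : w ∈ Set.range (act p)) :
    (u.1 ⨯₃ w.1, -(u.2 ⨯₃ w.2)) ∈ Set.range (act p) := by
  have hA' : (reflectB p).1.IsSymm := hA
  have hC' : (reflectB p).2.2.IsSymm := hC
  have hpos' : ∀ v, 0 ≤ quad (reflectB p) v := fun v ↦ by
    have := hpos (flipSnd v)
    rwa [← quad_reflectB_flipSnd, flipSnd_flipSnd] at this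
  have hnull' : ∀ v, act (reflectB p) v = 0 → sharpQuad (reflectB p) v = 0 := by
    intro v hv
    have h1 : act p (flipSnd v) = 0 := by
      have := act_reflectB p (flipSnd v)
      rw [flipSnd_flipSnd, hv] at this
      have h2 := congrArg flipSnd this
      rw [flipSnd_flipSnd] at h2
      rw [← h2]
      simp [flipSnd]
    have := hnull _ h1
    rwa [flipSnd_flipSnd, ← sharpQuad_reflectB] at this
  have hu' : flipSnd u ∈ Set.range (act (reflectB p)) := by
    rw [range_act_reflectB, flipSnd_flipSnd]; exact hu
  have hw' : flipSnd w ∈ Set.range (act (reflectB p)) := by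
    rw [range_act_reflectB, flipSnd_flipSnd]; exact hw
  have key := bracket_mem_range_act hA' hC' hpos' hnull' hu' hw'
  rw [range_act_reflectB] at key
  simpa [bracket, flipSnd] using key

end FrameConvention

end HamiltonODE

end Literature.Geometry.Riemannian

end
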